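import Mathlib
import Literature.Computability.AlgebraicComplexity.BooleanGadgets

/-!
# Route LiouvilleSarnak — crux `LiouvilleCutRank` (stmt-ValiantsHypothesis-14775):
# sign patterns of `λ` give one rich aligned block per cut word (route-independent tools)

Route-independent part (no `Theses` import) of
`Theorems/LiouvilleSarnakLiouvilleCutRankSignPatterns.lean`, which shows that the ONE-BLOCK form of the
crux `LiouvilleCutRank` (`Theorems/LiouvilleSarnakLiouvilleCutRankOneBlock.lean`: for every `W` one scale
`n₁` such that for every balanced cut `π₁` of `2n₁` positions SOME aligned block
`[4^{n₁} H + 1, 4^{n₁}(H + 1)]` of `λ`, read through `π₁`, has rank `≥ W`) is met by the SIGN-PATTERN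
consequence of Chowla's conjecture

  `(SP)  ∀ k, ∀ p : Fin k → Bool, ∃ m, ∀ i < k, λ(m + i + 1) = +1 if p i, else -1`

(every finite sign pattern occurs in `λ`; known for `k ≤ 3`, Matomäki–Radziwiłł–Tao; open in general).

* §1 digits: `N_{π₁}(r, c) = R(r) + C(c)` and `R(r) = Σ_i [r i] 2^{π₁(inl i)}` (with the tree's
  `BoolGadgets.ofBits_eq_sum`).
* §2 for odd `d`, subset sums of `≥ d - 1` powers of two fill `ℤ/d` (`|S ∪ (S + g)| ≥ min(d, |S|+1)`
  for a unit step `g`; `2 · (d+1)/2 = 1`).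
* §3 the sign matrix `J - 2I` of size `d ≥ 3` has rank `d` (explicit inverse
  `(2(d-2))⁻¹ J - ½ I`), and ★ `exists_block_rank_ge_of_signPatterns`: under `(SP)`, for every `W`
  and every balanced cut `π₁` of `2n₁` positions, `n₁ = 2W + 2`, SOME aligned `4^{n₁}`-block of `λ`
  has `π₁`-rank `≥ W` — ask `(SP)` for the pattern `[¬ d ∣ j]` (`d = 2W + 3`, `j < 2·4^{n₁}`) at `m`,
  take the aligned block starting inside it (offset `σ`), rows `r_t` with `R(r_t) ≡ t`, columns `c_t`
  with `C(c_t) ≡ -σ - t (mod d)`: the submatrix is `J - 2I`.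

Honest framing: `(SP)` is an open Chowla-strength hypothesis taken inline; nothing here is a claim
about VP versus VNP, and the crux `LiouvilleCutRank` stays OPEN.  No definitions.
-/

-- the directory `ValiantsHypothesis/ValiantsHypothesis` repeats the summit name (tree layout)
set_option linter.dupNamespace false

namespace Summit.ValiantsHypothesis.ValiantsHypothesis.Theorems.LiouvilleSarnakLiouvilleCutRank.SignPatterns

open ArithmeticFunction Finset

open Literature.Computability.AlgebraicComplexity.BoolGadgets (ofBits_eq_sum)

/-! ### §1 Digits: `N_{π₁}(r, c) = R(r) + C(c)` and the row value as a sum of powers of two -/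

/-- The cut number is the row part plus the column part (the digit supports are disjoint).
[folklore] -/
theorem ofBits_cut_eq_add (n₁ : ℕ) (π₁ : Fin n₁ ⊕ Fin n₁ ≃ Fin (2 * n₁)) (r c : Fin n₁ → Bool) :
    Nat.ofBits (fun j : Fin (2 * n₁) => Sum.elim r c (π₁.symm j)) =
      Nat.ofBits (fun j : Fin (2 * n₁) => Sum.elim r (fun _ => false) (π₁.symm j)) +
      Nat.ofBits (fun j : Fin (2 * n₁) => Sum.elim (fun _ => false) c (π₁.symm j)) := by
  rw [ofBits_eq_sum, ofBits_eq_sum, ofBits_eq_sum, ← Finset.sum_add_distrib]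
  refine Finset.sum_congr rfl fun j _ => ?_
  rcases π₁.symm j with i | i <;> simp

/-- The row part as a sum over the row positions: `R(r) = Σ_i [r i] 2^{π₁(inl i)}`. [folklore] -/
theorem ofBits_rows_eq_sum (n₁ : ℕ) (π₁ : Fin n₁ ⊕ Fin n₁ ≃ Fin (2 * n₁)) (r : Fin n₁ → Bool) :
    Nat.ofBits (fun j : Fin (2 * n₁) => Sum.elim r (fun _ => false) (π₁.symm j)) =
      ∑ i : Fin n₁, (r i).toNat * 2 ^ (π₁ (Sum.inl i) : ℕ) := by
  rw [ofBits_eq_sum]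
  rw [Fintype.sum_equiv π₁.symm
    (fun j : Fin (2 * n₁) => (Sum.elim r (fun _ => false) (π₁.symm j)).toNat * 2 ^ (j : ℕ))
    (fun x : Fin n₁ ⊕ Fin n₁ => (Sum.elim r (fun _ => false) x).toNat * 2 ^ (π₁ x : ℕ))
    (fun j => by simp only [Equiv.apply_symm_apply])]
  rw [Fintype.sum_sum_type]
  simp

/-- The column part as a sum over the column positions: `C(c) = Σ_i [c i] 2^{π₁(inr i)}`.
[folklore] -/
theorem ofBits_cols_eq_sum (n₁ : ℕ) (π₁ : Fin n₁ ⊕ Fin n₁ ≃ Fin (2 * n₁)) (c : Fin n₁ → Bool) :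
    Nat.ofBits (fun j : Fin (2 * n₁) => Sum.elim (fun _ => false) c (π₁.symm j)) =
      ∑ i : Fin n₁, (c i).toNat * 2 ^ (π₁ (Sum.inr i) : ℕ) := by
  rw [ofBits_eq_sum]
  rw [Fintype.sum_equiv π₁.symm
    (fun j : Fin (2 * n₁) => (Sum.elim (fun _ => false) c (π₁.symm j)).toNat * 2 ^ (j : ℕ))
    (fun x : Fin n₁ ⊕ Fin n₁ => (Sum.elim (fun _ => false) c x).toNat * 2 ^ (π₁ x : ℕ))
    (fun j => by simp only [Equiv.apply_symm_apply])]
  rw [Fintype.sum_sum_type]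
  simp

/-! ### §2 Subset sums of powers of two fill `ℤ/d` for odd `d` -/

/-- A nonempty subset of `ℤ/d` stable under adding a unit `g` is everything. [folklore] -/
theorem eq_univ_of_image_add_subset {d : ℕ} [NeZero d] (S : Finset (ZMod d)) (hS : S.Nonempty)
    (g : ZMod d) (u : ℕ) (hu : g * u = 1) (hinv : S.image (· + g) ⊆ S) : S = Finset.univ := by
  obtain ⟨x₀, hx₀⟩ := hS
  have hstep : ∀ x ∈ S, x + g ∈ S := fun x hx => hinv (Finset.mem_image_of_mem _ hx)
  have hmul : ∀ n : ℕ, x₀ + (n : ZMod d) * g ∈ S := by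
    intro n
    induction n with
    | zero => simpa using hx₀
    | succ n ih =>
      have := hstep _ ih
      push_cast
      convert this using 1
      ring
  apply Finset.eq_univ_of_forall
  intro y
  have key := hmul (((y - x₀) * u).val)
  rw [ZMod.natCast_zmod_val] at key
  convert key using 1
  calc y = x₀ + (y - x₀) * (g * u) := by rw [hu]; ring
    _ = x₀ + (y - x₀) * ↑u * g := by ring

/-- `|S ∪ (S + g)| ≥ min(d, |S| + 1)` for a nonempty `S ⊆ ℤ/d` and a unit step `g`. [folklore] -/
theorem min_le_card_union_image_add {d : ℕ} [NeZero d] (S : Finset (ZMod d)) (hS : S.Nonempty)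
    (g : ZMod d) (u : ℕ) (hu : g * u = 1) :
    min d (S.card + 1) ≤ (S ∪ S.image (· + g)).card := by
  by_cases h : S.image (· + g) ⊆ S
  · have hS' := eq_univ_of_image_add_subset S hS g u hu h
    have : (S ∪ S.image (· + g)).card = d := by
      rw [Finset.union_eq_left.mpr h, hS', Finset.card_univ, ZMod.card]
    rw [this]
    exact min_le_left _ _
  · rw [Finset.not_subset] at h
    obtain ⟨y, hy, hyS⟩ := h
    refine (min_le_right _ _).trans ?_
    calc S.card + 1 = (insert y S).card := (Finset.card_insert_of_notMem hyS).symm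
      _ ≤ (S ∪ S.image (· + g)).card :=
          Finset.card_le_card (Finset.insert_subset (Finset.mem_union_right _ hy)
            Finset.subset_union_left)

/-- `2` is a unit mod an odd `d`: `2 · (d+1)/2 = 1` in `ℤ/d`. [folklore] -/
theorem two_mul_half_succ_eq_one {d : ℕ} (hd : Odd d) :
    (2 : ZMod d) * (((d + 1) / 2 : ℕ) : ZMod d) = 1 := by
  have h : 2 * ((d + 1) / 2) = d + 1 := Nat.two_mul_div_two_of_even (hd.add_one)
  calc (2 : ZMod d) * (((d + 1) / 2 : ℕ) : ZMod d) = ((2 * ((d + 1) / 2) : ℕ) : ZMod d) := by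
        push_cast; ring
    _ = ((d + 1 : ℕ) : ZMod d) := by rw [h]
    _ = 1 := by push_cast; rw [ZMod.natCast_self, zero_add]

/-- **Subset sums of powers of two fill `ℤ/d`.**  For odd `d` and any exponents `q_0, …, q_{k-1}`,
the subset sums `Σ_i ε_i 2^{q_i}` (`ε ∈ {0,1}^k`) take at least `min(d, k + 1)` values mod `d`
(each `2^{q}` is a unit; add one exponent at a time). [folklore] -/
theorem min_le_card_image_subsetSum {d : ℕ} [NeZero d] (hd : Odd d) :
    ∀ (k : ℕ) (q : Fin k → ℕ),
      min d (k + 1) ≤ (Finset.univ.image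
        (fun ε : Fin k → Bool => ∑ i, ((ε i).toNat : ZMod d) * 2 ^ q i)).card := by
  intro k
  induction k with
  | zero =>
    intro q
    have : (Finset.univ.image
        (fun ε : Fin 0 → Bool => ∑ i, ((ε i).toNat : ZMod d) * 2 ^ q i)).card = 1 := by
      rw [Finset.card_eq_one]
      exact ⟨0, by ext x; simp⟩
    rw [this]
    exact min_le_right _ _
  | succ k ih =>
    intro q
    set g : ZMod d := 2 ^ q 0 with hg
    set S : Finset (ZMod d) := Finset.univ.image
      (fun ε : Fin k → Bool => ∑ i, ((ε i).toNat : ZMod d) * 2 ^ q (Fin.succ i)) with hSdef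
    have hS : min d (k + 1) ≤ S.card := ih (fun i => q i.succ)
    have hu : g * ((((d + 1) / 2) ^ q 0 : ℕ) : ZMod d) = 1 := by
      rw [hg]
      push_cast
      rw [← mul_pow, two_mul_half_succ_eq_one hd, one_pow]
    have hsub : S ∪ S.image (· + g) ⊆ Finset.univ.image
        (fun ε : Fin (k + 1) → Bool => ∑ i, ((ε i).toNat : ZMod d) * 2 ^ q i) := by
      intro x hx
      rw [Finset.mem_image]
      rcases Finset.mem_union.mp hx with hx | hx
      · obtain ⟨ε, -, rfl⟩ := Finset.mem_image.mp hx
        refine ⟨Fin.cons false ε, Finset.mem_univ _, ?_⟩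
        rw [Fin.sum_univ_succ]
        simp [Fin.cons_zero, Fin.cons_succ]
      · obtain ⟨y, hy, rfl⟩ := Finset.mem_image.mp hx
        obtain ⟨ε, -, rfl⟩ := Finset.mem_image.mp hy
        refine ⟨Fin.cons true ε, Finset.mem_univ _, ?_⟩
        rw [Fin.sum_univ_succ]
        simp [Fin.cons_zero, Fin.cons_succ, hg]
        ring
    have hSne : S.Nonempty :=
      ⟨_, Finset.mem_image_of_mem _ (Finset.mem_univ (fun _ : Fin k => false))⟩
    calc min d (k + 1 + 1) ≤ min d (S.card + 1) := by
          simp only [Nat.min_def] at hS ⊢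
          split_ifs at hS ⊢ <;> omega
      _ ≤ (S ∪ S.image (· + g)).card := min_le_card_union_image_add S hSne g _ hu
      _ ≤ _ := Finset.card_le_card hsub

/-- **Every residue is a subset sum** when there are `≥ d - 1` exponents (`d` odd). [folklore] -/
theorem exists_subsetSum_eq {d : ℕ} [NeZero d] (hd : Odd d) (k : ℕ) (hk : d ≤ k + 1)
    (q : Fin k → ℕ) (t : ZMod d) :
    ∃ ε : Fin k → Bool, (∑ i, ((ε i).toNat : ZMod d) * 2 ^ q i) = t := by
  set T := Finset.univ.image (fun ε : Fin k → Bool => ∑ i, ((ε i).toNat : ZMod d) * 2 ^ q i)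
    with hT
  have hcard : T.card = Fintype.card (ZMod d) := by
    apply le_antisymm (Finset.card_le_univ _)
    rw [ZMod.card]
    have := min_le_card_image_subsetSum hd k q
    rw [min_eq_left hk] at this
    exact this
  have hmem : t ∈ T := by rw [Finset.eq_univ_of_card T hcard]; exact Finset.mem_univ _
  obtain ⟨ε, -, hε⟩ := Finset.mem_image.mp hmem
  exact ⟨ε, hε⟩

/-! ### §3 The sign matrix `J - 2I` and the main theorem -/

/-- The `±1` matrix with `-1` exactly on the diagonal (`J - 2I`) of size `d ≥ 3` is invertible, hence
has rank `d`: `(J - 2I) · ((2(d-2))⁻¹ J - ½ I) = I`. [folklore] -/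
theorem rank_diagSign {d : ℕ} [NeZero d] (hd : 3 ≤ d) :
    (Matrix.of fun t t' : ZMod d => if t = t' then (-1 : ℂ) else 1).rank = d := by
  set Q : Matrix (ZMod d) (ZMod d) ℂ := Matrix.of fun t t' : ZMod d => if t = t' then (-1 : ℂ) else 1
    with hQ
  have hd2 : (d : ℂ) - 2 ≠ 0 := by
    have : ((d - 2 : ℕ) : ℂ) = (d : ℂ) - 2 := by
      rw [Nat.cast_sub (by omega)]; norm_num
    rw [← this, Nat.cast_ne_zero]
    omega
  set a : ℂ := 1 / (2 * ((d : ℂ) - 2)) with ha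
  set B : Matrix (ZMod d) (ZMod d) ℂ :=
    Matrix.of fun t t' : ZMod d => a + (if t = t' then (-1 / 2 : ℂ) else 0) with hB
  have hrowsum : ∀ t : ZMod d, ∑ k : ZMod d, (if t = k then (-1 : ℂ) else 1) = (d : ℂ) - 2 := by
    intro t
    have h1 : ∀ k : ZMod d, (if t = k then (-1 : ℂ) else 1) = 1 - 2 * (if t = k then (1 : ℂ) else 0) := by
      intro k; split_ifs <;> norm_num
    simp_rw [h1]
    rw [Finset.sum_sub_distrib, ← Finset.mul_sum, Finset.sum_ite_eq, Finset.sum_const,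
      Finset.card_univ, ZMod.card]
    simp
  have hQB : Q * B = 1 := by
    ext t t'
    rw [Matrix.mul_apply, Matrix.one_apply]
    have hsplit : ∀ k : ZMod d, Q t k * B k t' =
        (if t = k then (-1 : ℂ) else 1) * a +
          (if t = k then (-1 : ℂ) else 1) * (if k = t' then (-1 / 2 : ℂ) else 0) := by
      intro k
      simp only [hQ, hB, Matrix.of_apply]
      ring
    simp_rw [hsplit]
    rw [Finset.sum_add_distrib, ← Finset.sum_mul, hrowsum]
    have h2 : ∑ k : ZMod d, (if t = k then (-1 : ℂ) else 1) * (if k = t' then (-1 / 2 : ℂ) else 0) =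
        (if t = t' then (-1 : ℂ) else 1) * (-1 / 2) := by
      simp_rw [mul_ite, mul_zero]
      rw [Finset.sum_ite_eq' Finset.univ t']
      simp
    rw [h2, ha]
    split_ifs <;> field_simp <;> ring
  have hunit : IsUnit Q := ⟨⟨Q, B, hQB, (mul_eq_one_comm.mp hQB)⟩, rfl⟩
  rw [Matrix.rank_of_isUnit Q hunit, ZMod.card]

/-- ★ **Sign patterns give one rich block per cut word.**  Under `(SP)`, for every `W` and every
balanced cut `π₁` of `2n₁` positions, `n₁ = 2W + 2`, some aligned block `[4^{n₁} H + 1, 4^{n₁}(H+1)]`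
of `λ` has `π₁`-cut-matrix rank `≥ W` (pattern `[¬ d ∣ j]`, `d = 2W + 3`; rows / columns realising
all residues mod `d`; submatrix `J - 2I` of rank `d`). [folklore] -/
theorem exists_block_rank_ge_of_signPatterns
    (hpat : ∀ k : ℕ, ∀ p : Fin k → Bool, ∃ m : ℕ, ∀ i : Fin k,
      liouville (m + i + 1) = if p i then 1 else -1) (W : ℕ) :
    ∀ π₁ : Fin (2 * W + 2) ⊕ Fin (2 * W + 2) ≃ Fin (2 * (2 * W + 2)), ∃ H : ℕ,
      W ≤ (Matrix.of fun r c : Fin (2 * W + 2) → Bool =>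
        (((liouville (Nat.ofBits (fun j : Fin (2 * (2 * W + 2)) => Sum.elim r c (π₁.symm j)) +
          2 ^ (2 * (2 * W + 2)) * H + 1) : ℤ) : ℂ))).rank := by
  classical
  -- parameters
  set d : ℕ := 2 * W + 3 with hd
  haveI : NeZero d := ⟨by omega⟩
  have hdodd : Odd d := ⟨W + 1, by omega⟩
  have hd3 : 3 ≤ d := by omega
  set n₁ : ℕ := 2 * W + 2 with hn₁
  intro π₁
  set L : ℕ := 2 ^ (2 * n₁) with hL
  have hLpos : 0 < L := Nat.two_pow_pos _
  -- the pattern `[¬ d ∣ j]` of length `2L`, occurring at `m`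
  obtain ⟨m, hm⟩ := hpat (2 * L) (fun j => decide (¬ d ∣ (j : ℕ)))
  -- the aligned block inside the occurrence
  set H : ℕ := m / L + 1 with hH
  have hmH : m < L * H := Nat.lt_mul_div_succ m hLpos
  have hHm : L * H ≤ m + L := by
    rw [hH, Nat.mul_add, mul_one]
    exact Nat.add_le_add_right (Nat.mul_div_le m L) L
  set σ : ℕ := L * H - m with hσ
  refine ⟨H, ?_⟩
  -- row / column parts and their residues
  set R : (Fin n₁ → Bool) → ℕ := fun r =>
    Nat.ofBits (fun j : Fin (2 * n₁) => Sum.elim r (fun _ => false) (π₁.symm j)) with hR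
  set C : (Fin n₁ → Bool) → ℕ := fun c =>
    Nat.ofBits (fun j : Fin (2 * n₁) => Sum.elim (fun _ => false) c (π₁.symm j)) with hC
  have hRres : ∀ t : ZMod d, ∃ r : Fin n₁ → Bool, (R r : ZMod d) = t := by
    intro t
    obtain ⟨ε, hε⟩ := exists_subsetSum_eq hdodd n₁ (by omega)
      (fun i => (π₁ (Sum.inl i) : ℕ)) t
    refine ⟨ε, ?_⟩
    rw [hR]
    simp only
    rw [ofBits_rows_eq_sum]
    push_cast
    exact hε
  have hCres : ∀ t : ZMod d, ∃ c : Fin n₁ → Bool, (C c : ZMod d) = t := by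
    intro t
    obtain ⟨ε, hε⟩ := exists_subsetSum_eq hdodd n₁ (by omega)
      (fun i => (π₁ (Sum.inr i) : ℕ)) t
    refine ⟨ε, ?_⟩
    rw [hC]
    simp only
    rw [ofBits_cols_eq_sum]
    push_cast
    exact hε
  choose ρ hρ using hRres
  choose γ hγ using fun t : ZMod d => hCres (-(σ : ZMod d) - t)
  -- the block matrix and its `J - 2I` submatrix
  set A : Matrix (Fin n₁ → Bool) (Fin n₁ → Bool) ℂ := Matrix.of fun r c : Fin n₁ → Bool =>
      (((liouville (Nat.ofBits (fun j : Fin (2 * n₁) => Sum.elim r c (π₁.symm j)) +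
        L * H + 1) : ℤ) : ℂ)) with hA
  have hentry : ∀ t t' : ZMod d, A (ρ t) (γ t') = if t = t' then (-1 : ℂ) else 1 := by
    intro t t'
    have hN : Nat.ofBits (fun j : Fin (2 * n₁) => Sum.elim (ρ t) (γ t') (π₁.symm j)) =
        R (ρ t) + C (γ t') := ofBits_cut_eq_add n₁ π₁ (ρ t) (γ t')
    have hNlt : R (ρ t) + C (γ t') < L := by
      rw [← hN, hL]; exact Nat.ofBits_lt_two_pow _
    have hj : σ + (R (ρ t) + C (γ t')) < 2 * L := by omega
    have harg : R (ρ t) + C (γ t') + L * H + 1 =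
        m + (σ + (R (ρ t) + C (γ t'))) + 1 := by
      omega
    have hlam := hm ⟨σ + (R (ρ t) + C (γ t')), hj⟩
    simp only [decide_eq_true_eq] at hlam
    rw [hA, Matrix.of_apply, hN, harg, hlam]
    -- `d ∣ σ + R + C` iff `t = t'`
    have hdvd : d ∣ σ + (R (ρ t) + C (γ t')) ↔ t = t' := by
      rw [← ZMod.natCast_eq_zero_iff]
      push_cast
      rw [hρ t, hγ t']
      constructor
      · intro h; linear_combination h
      · intro h; rw [h]; ring
    by_cases htt : t = t'
    · rw [if_neg (not_not.mpr (hdvd.mpr htt)), if_pos htt]; norm_num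
    · rw [if_pos (fun h => htt (hdvd.mp h)), if_neg htt]; norm_num
  have hsub : A.submatrix ρ γ = Matrix.of fun t t' : ZMod d => if t = t' then (-1 : ℂ) else 1 := by
    ext t t'
    rw [Matrix.submatrix_apply, hentry, Matrix.of_apply]
  calc W ≤ d := by omega
    _ = (Matrix.of fun t t' : ZMod d => if t = t' then (-1 : ℂ) else 1).rank := (rank_diagSign hd3).symm
    _ = (A.submatrix ρ γ).rank := by rw [hsub]
    _ ≤ A.rank := Matrix.rank_submatrix_le A ρ γ

end Summit.ValiantsHypothesis.ValiantsHypothesis.Theorems.LiouvilleSarnakLiouvilleCutRank.SignPatterns
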